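import Mathlib.CategoryTheory.InducedCategory
import Mathlib.CategoryTheory.EssentialImage
import Literature.AlgebraicGeometry.Frobenioids.BiratPaths
import Literature.AlgebraicGeometry.Frobenioids.BaseFrobeniusSections
import Literature.AlgebraicGeometry.Frobenioids.BiratGerms
import HarnessLib

/-!
# Frobenioids I, Theorem 5.2 (iv), proof step: every object admits an `F_P`-path; `C′ → C` is an
equivalence

Mochizuki, *The geometry of Frobenioids I: the general theory*, Kyushu J. Math. **62** (2008)
293–400, §5, proof of Theorem 5.2 (iv), kurims text pp. 101–102 [cite: MochizukiFrdI2008, Thm.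
5.2(iv) p.101]:
"Let `(P, F)` be a base-Frobenius pair of `C` … If `C ∈ Ob(C)`, then let us refer to a[n ordered]
pair of pre-steps … such that `A ∈ Ob(P)` as an `F_P`-path for `C`. Write `C′` for the category
whose
objects are objects of `C` equipped with an `F_P`-path … Thus, we have a natural functor `C′ → C` …
which is manifestly an equivalence of categories."

For a base-section `P` (Def. 2.7 (i), seat L1-t2) of a Frobenioid of isotropic type every object `X`
admits an `F_P`-path: `P → D` is essentially surjective, so some `A ∈ Ob(P)` has `Base A ≅ Base X`,
and Def. 1.3 (i)(b) realises this base-isomorphism by a pair of pre-steps `B → A`, `B → X`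
(co-angular by isotropy).  Hence the forgetful functor `C′ → C` (`PathCat`, an induced — so fully
faithful — category over `C`) is an equivalence.
-/

namespace Literature.AlgebraicGeometry.Frobenioids

open CategoryTheory Opposite

universe w v v' u u'

namespace PreFrobenioid

variable {D : Type u} [Category.{v} D] {Φ : Dᵒᵖ ⥤ CommMonCat.{w}}
  {C : Type u'} [Category.{v'} C]

variable (F : C ⥤ ElemFrobenioid Φ) in
/-- The objects of `C′`: objects of `C` equipped with an `F_P`-path.
[cite: MochizukiFrdI2008, Thm. 5.2(iv) p.101] -/
def PathObj (P : Set C) : Type (max u' v') := Σ X : C, FPPath F P X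

variable (F : C ⥤ ElemFrobenioid Φ) in
/-- **The category `C′`** of objects equipped with an `F_P`-path, morphisms those of `C` between the
underlying objects (an induced category over `C`). [cite: MochizukiFrdI2008, Thm. 5.2(iv) p.101] -/
def PathCat (P : Set C) : Type (max u' v') := InducedCategory C (fun x : PathObj F P => x.1)

namespace PathCat

variable {F : C ⥤ ElemFrobenioid Φ} {P : Set C}

/-- The category structure of `C′` (induced from `C`). [cite: MochizukiFrdI2008, Thm. 5.2(iv) p.101] -/
noncomputable instance instCategory : Category (PathCat F P) :=
  inferInstanceAs (Category (InducedCategory C (fun x : PathObj F P => x.1)))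

variable (F P) in
/-- The forgetful functor `C′ → C`. [cite: MochizukiFrdI2008, Thm. 5.2(iv) p.102] -/
noncomputable def forget : PathCat F P ⥤ C := inducedFunctor (fun x : PathObj F P => x.1)

/-- The underlying object. [cite: MochizukiFrdI2008, Thm. 5.2(iv) p.101] -/
def pt (x : PathCat F P) : C := x.1

/-- The chosen `F_P`-path. [cite: MochizukiFrdI2008, Thm. 5.2(iv) p.101] -/
def path (x : PathCat F P) : FPPath F P x.pt := x.2

/-- `C′ → C` is full (induced category). [cite: MochizukiFrdI2008, Thm. 5.2(iv) p.102] -/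
noncomputable instance forget_full : (forget F P).Full :=
  inferInstanceAs (inducedFunctor (fun x : PathObj F P => x.1)).Full

/-- `C′ → C` is faithful (induced category). [cite: MochizukiFrdI2008, Thm. 5.2(iv) p.102] -/
instance forget_faithful : (forget F P).Faithful :=
  inferInstanceAs (inducedFunctor (fun x : PathObj F P => x.1)).Faithful

/-- `C′ → C` is essentially surjective as soon as every object admits an `F_P`-path.
[cite: MochizukiFrdI2008, Thm. 5.2(iv) p.102] -/
theorem forget_essSurj (h : ∀ X : C, Nonempty (FPPath F P X)) : (forget F P).EssSurj where
  mem_essImage X := ⟨⟨X, (h X).some⟩, ⟨Iso.refl X⟩⟩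

/-- `C′ → C` "is manifestly an equivalence of categories" (given `F_P`-paths for all objects).
[cite: MochizukiFrdI2008, Thm. 5.2(iv) p.102] -/
theorem forget_isEquivalence (h : ∀ X : C, Nonempty (FPPath F P X)) :
    (forget F P).IsEquivalence :=
  haveI := forget_essSurj h
  {}

end PathCat

/-- **Every object admits an `F_P`-path** for a base-section `P` of a Frobenioid of isotropic type:
`P → D` essentially surjective + Def. 1.3 (i)(b) + isotropy. [cite: MochizukiFrdI2008, Thm. 5.2(iv)
p.101] -/
theorem nonempty_fpPath {F : C ⥤ ElemFrobenioid Φ} (hF : IsFrobenioid F)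
    (hiso : IsOfIsotropicType F)
    {P : Presection C} (hP : IsBaseSection F P) (X : C) :
    Nonempty (FPPath F {A | P.obj A} X) := by
  haveI := hP.isEquivalence
  obtain ⟨a, ⟨i⟩⟩ : (P.toBase F).essImage (baseObj F X) :=
    Functor.EssSurj.mem_essImage (F := P.toBase F) (baseObj F X)
  obtain ⟨B, φ, ψ, hφ, hψ, -⟩ := hF.i_b a.1 X i
  exact ⟨⟨a.1, B, φ, ψ, a.2, isCoAngularPreStep_of_isotropic hiso hφ,
    isCoAngularPreStep_of_isotropic hiso hψ⟩⟩

/-- For a base-section `P` (so `P → D` is an equivalence), every base morphism between objects of `P`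
lifts UNIQUELY to a (`P`-distinguished) morphism of `P` — the "`P`-part" of the factorisations used in
the proof of Thm. 5.2 (iv) (Remark 2.7.2). [cite: MochizukiFrdI2008, Def. 2.7(i) p.51] -/
theorem IsBaseSection.existsUnique_hom_over {F : C ⥤ ElemFrobenioid Φ} {P : Presection C}
    (hP : IsBaseSection F P) (A A' : P.Cat) (f : baseObj F A.1 ⟶ baseObj F A'.1) :
    ∃! π : A ⟶ A', Base F π.1 = f := by
  haveI := hP.isEquivalence
  obtain ⟨π, hπ⟩ := (P.toBase F).map_surjective (X := A) (Y := A') f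
  exact ⟨π, hπ, fun π' hπ' => (P.toBase F).map_injective (hπ'.trans hπ.symm)⟩

/-- Hence, for a Frobenioid of isotropic and pre-model type (base-Frobenius pair `(P, F)`), the
forgetful functor `C′ → C` is an equivalence. [cite: MochizukiFrdI2008, Thm. 5.2(iv) p.102] -/
theorem PathCat.forget_isEquivalence_of_isBaseSection {F : C ⥤ ElemFrobenioid Φ}
    (hF : IsFrobenioid F)
    (hiso : IsOfIsotropicType F) {P : Presection C} (hP : IsBaseSection F P) :
    (PathCat.forget F {A | P.obj A}).IsEquivalence :=
  PathCat.forget_isEquivalence (nonempty_fpPath hF hiso hP)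

end PreFrobenioid

end Literature.AlgebraicGeometry.Frobenioids
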